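import Summits.QuantumFields.YangMills.Theorems.FradkinShenkerFlowClusteringToYangMillsStubCylinderApprox
import Summits.QuantumFields.YangMills.Theorems.FradkinShenkerFlowClusteringToYangMillsStubReconstructibleGeometry
import HarnessLib

/-!
# `stub_admissibleGivesGap`, helper 4/4: gauge invariance of odd-torus limit states

Support file for crux `stmt-QuantumFields-8762`
(`Summit.QuantumFields.YangMills.Theses.EquipartitionCriticality.CriticalContinuumLimit`), line
`Sketch`, stub `stub_admissibleGivesGap` (I0 = RQ of line `spectral-requantisation-dock` of crux
`ClusteringToYangMills`, stmt-QuantumFields-9443): torus clustering at `β` with rate `m` ⟹ every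
odd-torus limit state is OS-reconstructible with transfer gap `≥ m`. The stub is assembled in
`EquipartitionCriticalityCriticalContinuumLimitStubAdmissibleGivesGap.lean` from four helper files
(`…LTwo`, `…TorusRP`, `…Gauge`, `…GaugeInvariance`) and the landed RQ0/RQb2 of 9443.

**This file.** Every odd-torus limit state `μ` is invariant under all gauge transformations of
`ℤ⁴` (`map_gaugeTransformZd_eq`, registered as `admissibleGap_gaugeInvariance`): on a fixed
bounded continuous cylinder observable, a `ℤ⁴` gauge transformation `g` acts, on every torus large
enough for the endpoints of the support to embed injectively, as a torus gauge transformation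
(`exists_torus_gauge`, `apply_gaugeTransformZd_torusLift`), under which the Wilson state is
invariant (`wilsonMeasure_map_gaugeTransform`); the equality of integrals passes to the limit and
`CylinderExt` upgrades it to an equality of measures. (The elementary geometry of gauge
transformations is repeated privately from helper 3/4 to keep the helper files independent.)

References: K. Osterwalder, E. Seiler, Ann. Phys. 110 (1978) 440, §2; E. Seiler, LNP 159 (1982)
Ch. 2; J. Glimm, A. Jaffe, *Quantum Physics* (1987) §6.1; J. Fröhlich, R. Israel, E. Lieb,
B. Simon, Comm. Math. Phys. 62 (1978) 1, §2–3.
-/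

noncomputable section

open scoped BigOperators Topology ENNReal ComplexConjugate ComplexOrder
open MeasureTheory Filter
open Literature.MathematicalPhysics Literature.MathematicalPhysics.QuantumFieldTheory
  Literature.MathematicalPhysics.QuantumLattice
open Literature.Probability.LatticeModels (IsOSReconstructible IsBoundedMeasurable positiveEvents osForm)

namespace Summit.QuantumFields.YangMills.Theorems.CriticalContinuumLimit.AdmissibleGap

open Summit.QuantumFields.YangMills.Theorems.ClusteringToYangMills
open Summit.QuantumFields.YangMills.Theorems.ClusteringToYangMills.Reconstructible

section GaugeGeometry

variable {G : Type} [Group G]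

/-- Gauge transforms of cylinder observables are cylinder observables (same support). [folklore] -/
private theorem isCylinder_comp_gaugeTransformZd {α : Type*} {F : LGConfig 4 G → α} {Λ : Finset (QuantumLattice.ZdEdge 4)}
    (hF : IsCylinder F Λ) (g : (Fin 4 → ℤ) → G) : IsCylinder (fun U => F (gaugeTransformZd g U)) Λ := by
  intro U V hUV
  refine hF fun e he => ?_
  simp only [gaugeTransformZd, hUV e he]

/-- Gauge transformations are continuous. [folklore] -/
private theorem continuous_gaugeTransformZd [TopologicalSpace G] [IsTopologicalGroup G] (g : (Fin 4 → ℤ) → G) :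
    Continuous (gaugeTransformZd g : LGConfig 4 G → LGConfig 4 G) :=
  continuous_pi fun e => (continuous_const.mul (continuous_apply e)).mul continuous_const

/-- Gauge transformations are measurable. [folklore] -/
private theorem measurable_gaugeTransformZd [MeasurableSpace G] [MeasurableMul G] (g : (Fin 4 → ℤ) → G) :
    Measurable (gaugeTransformZd g : LGConfig 4 G → LGConfig 4 G) :=
  measurable_pi_lambda _ fun e => by
    simp only [gaugeTransformZd]
    have hm : Measurable fun U : LGConfig 4 G => U e := measurable_pi_apply e
    exact (hm.const_mul (g e.1)).mul_const _

/-- The endpoints of a finite set of links. [folklore] -/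
private def ends (Λ : Finset (QuantumLattice.ZdEdge 4)) : Finset (Fin 4 → ℤ) :=
  Λ.image (fun e => e.1) ∪ Λ.image (fun e => e.1 + Pi.single e.2 1)

/-- Base points are endpoints. [folklore] -/
private theorem fst_mem_ends {Λ : Finset (QuantumLattice.ZdEdge 4)} {e : QuantumLattice.ZdEdge 4} (he : e ∈ Λ) : e.1 ∈ ends Λ :=
  Finset.mem_union_left _ (Finset.mem_image_of_mem _ he)

/-- Tips are endpoints. [folklore] -/
private theorem tip_mem_ends {Λ : Finset (QuantumLattice.ZdEdge 4)} {e : QuantumLattice.ZdEdge 4} (he : e ∈ Λ) : e.1 + Pi.single e.2 1 ∈ ends Λ :=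
  Finset.mem_union_right _ (Finset.mem_image_of_mem (fun e : QuantumLattice.ZdEdge 4 => e.1 + Pi.single e.2 1) he)

/-! #### Matching `ℤ⁴` gauge transformations with torus gauge transformations on large tori -/

/-- `proj (x + eᵢ) = (proj x).shift i`. [folklore] -/
theorem proj_add_single_eq_shift (L : ℕ) (x : Fin 4 → ℤ) (i : Fin 4) :
    Literature.Probability.LatticeModels.Torus.proj L (x + Pi.single i 1) =
      Site.shift (Literature.Probability.LatticeModels.Torus.proj L x) i := by
  funext j
  by_cases hj : j = i
  · subst hj; simp [Site.shift]
  · simp [Site.shift, hj]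

/-- A finite set of sites of `ℤ⁴` embeds injectively into all large tori. [folklore] -/
theorem eventually_injOn_proj (B : Finset (Fin 4 → ℤ)) :
    ∀ᶠ L : ℕ in atTop, Set.InjOn (Literature.Probability.LatticeModels.Torus.proj (d := 4) (L + 1)) ↑B := by
  filter_upwards [eventually_injOn_torusEdge (d := 4) (B.image fun x => (x, (0 : Fin 4)))] with L hL
  intro x hx y hy hxy
  have h := hL (Finset.mem_coe.2 (Finset.mem_image_of_mem _ (Finset.mem_coe.1 hx)))
    (Finset.mem_coe.2 (Finset.mem_image_of_mem _ (Finset.mem_coe.1 hy)))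
    (by simp only [torusEdge, hxy])
  exact (Prod.mk.injEq _ _ _ _ ▸ h).1

/-- On a torus into which `B` embeds, every `ℤ⁴` gauge transformation is matched on `B` by a
torus gauge transformation. [folklore] -/
theorem exists_torus_gauge (g : (Fin 4 → ℤ) → G) {B : Finset (Fin 4 → ℤ)} {L : ℕ}
    (hinj : Set.InjOn (Literature.Probability.LatticeModels.Torus.proj (d := 4) L) ↑B) :
    ∃ gT : Site 4 L → G, ∀ x ∈ B, gT (Literature.Probability.LatticeModels.Torus.proj L x) = g x := by
  classical
  refine ⟨fun y => if h : ∃ x ∈ B, Literature.Probability.LatticeModels.Torus.proj L x = y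
    then g h.choose else 1, fun x hx => ?_⟩
  have h : ∃ x' ∈ B, Literature.Probability.LatticeModels.Torus.proj L x' =
      Literature.Probability.LatticeModels.Torus.proj L x := ⟨x, hx, rfl⟩
  dsimp only
  rw [dif_pos h]
  congr 1
  exact hinj (Finset.mem_coe.2 h.choose_spec.1) (Finset.mem_coe.2 hx) h.choose_spec.2

/-- **The periodic lift intertwines matched gauge transformations** on the links of `Λ`. [folklore] -/
theorem apply_gaugeTransformZd_torusLift {α : Type*} {F : LGConfig 4 G → α} {Λ : Finset (QuantumLattice.ZdEdge 4)}
    (hF : IsCylinder F Λ) {g : (Fin 4 → ℤ) → G} {L : ℕ} {gT : Site 4 L → G}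
    (hgT : ∀ x ∈ ends Λ, gT (Literature.Probability.LatticeModels.Torus.proj L x) = g x)
    (V : GaugeConfig 4 L G) :
    F (gaugeTransformZd g (torusLift L V)) = F (torusLift L (gaugeTransform gT V)) := by
  refine hF fun e he => ?_
  have he' := Finset.mem_coe.1 he
  simp only [gaugeTransformZd, torusLift, Function.comp_apply, torusEdge, gaugeTransform,
    ← proj_add_single_eq_shift, hgT _ (fst_mem_ends he'), hgT _ (tip_mem_ends he')]

end GaugeGeometry

/-! ### Gauge invariance of odd-torus limit states -/

section GaugeInvariance

variable {G : Type} [Group G] [TopologicalSpace G] [IsTopologicalGroup G] [CompactSpace G]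
  [MeasurableSpace G] [BorelSpace G] [SecondCountableTopology G]

variable (r : LatticeRep G) {β : ℝ} {μ : Measure (LGConfig 4 G)}

/-- **Odd-torus limit states are gauge invariant on continuous cylinder observables**: the torus
Wilson states are gauge invariant (`wilsonMeasure_map_gaugeTransform`) and on large tori every
`ℤ⁴` gauge transformation acts on a fixed cylinder observable as a torus gauge transformation.
[folklore] -/
theorem integral_comp_gaugeTransformZd_eq (hμ : μ ∈ oddTorusLimitPoints r β) (g : (Fin 4 → ℤ) → G)
    (F : LGConfig 4 G → ℝ) (Λ : Finset (QuantumLattice.ZdEdge 4)) (hF : IsCylinder F Λ) (hFc : Continuous F)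
    (hFb : ∃ C, ∀ U, |F U| ≤ C) :
    ∫ U, F (gaugeTransformZd g U) ∂μ = ∫ U, F U ∂μ := by
  obtain ⟨S, hS, -, hlim⟩ := hμ
  have t1 := hlim (fun U => F (gaugeTransformZd g U)) Λ (isCylinder_comp_gaugeTransformZd hF g)
    (hFc.comp (continuous_gaugeTransformZd g)) (by obtain ⟨C, hC⟩ := hFb; exact ⟨C, fun U => hC _⟩)
  have t2 := hlim F Λ hF hFc hFb
  obtain ⟨R, hR⟩ := eventually_atTop.1 (eventually_injOn_proj (ends Λ))
  have hev : ∀ᶠ k in atTop,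
      wilsonExpectation (L := 2 * S k + 1) r.ρ β
          (toTorusObservable (2 * S k + 1) fun U => F (gaugeTransformZd g U)) =
        wilsonExpectation (L := 2 * S k + 1) r.ρ β (toTorusObservable (2 * S k + 1) F) := by
    filter_upwards [hS.tendsto_atTop.eventually (eventually_ge_atTop R)] with k hk
    obtain ⟨gT, hgT⟩ := exists_torus_gauge g (hR (2 * S k) (by omega))
    have hpt : (toTorusObservable (2 * S k + 1) fun U => F (gaugeTransformZd g U)) =
        fun V => toTorusObservable (2 * S k + 1) F (gaugeTransform gT V) := by
      funext V
      exact apply_gaugeTransformZd_torusLift hF hgT V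
    have hsm : AEStronglyMeasurable (toTorusObservable (2 * S k + 1) F)
        ((wilsonMeasure (d := 4) (L := 2 * S k + 1) r.ρ β).map (gaugeTransform gT)) :=
      (hFc.measurable.comp (measurable_torusLift _)).aestronglyMeasurable
    rw [hpt, wilsonExpectation, wilsonExpectation,
      ← integral_map (WilsonGauge.measurePreserving_gaugeTransform gT).measurable.aemeasurable hsm,
      wilsonMeasure_map_gaugeTransform_holds r.ρ β gT]
  exact tendsto_nhds_unique (t1.congr' hev) t2

/-- **Odd-torus limit states are gauge invariant** (given `CylinderExt`). [folklore] -/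
theorem map_gaugeTransformZd_eq [IsProbabilityMeasure μ] (hμ : μ ∈ oddTorusLimitPoints r β)
    (hExt : CylinderExt G) (g : (Fin 4 → ℤ) → G) : μ.map (gaugeTransformZd g) = μ := by
  haveI : IsProbabilityMeasure (μ.map (gaugeTransformZd g)) :=
    Measure.isProbabilityMeasure_map (measurable_gaugeTransformZd g).aemeasurable
  refine hExt _ _ fun F Λ hF hFc hFb => ?_
  rw [integral_map (measurable_gaugeTransformZd g).aemeasurable hFc.measurable.aestronglyMeasurable]
  exact integral_comp_gaugeTransformZd_eq r hμ g F Λ hF hFc hFb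

end GaugeInvariance

end Summit.QuantumFields.YangMills.Theorems.CriticalContinuumLimit.AdmissibleGap

namespace Summit.QuantumFields.YangMills.Theorems.CriticalContinuumLimit

/-- **Registered helper `admissibleGap_gaugeInvariance`** (stub `stub_admissibleGivesGap`, helper
4/4): odd-torus limit states over a second countable compact group are invariant under every gauge
transformation of `ℤ⁴` (given `CylinderExt G`). [folklore] -/
theorem admissibleGap_gaugeInvariance (G : Type) [Group G] [TopologicalSpace G] [IsTopologicalGroup G]
    [CompactSpace G] [MeasurableSpace G] [BorelSpace G] [SecondCountableTopology G]
    (r : LatticeRep G) (β : ℝ) (μ : Measure (LGConfig 4 G)) [IsProbabilityMeasure μ]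
    (hμ : μ ∈ oddTorusLimitPoints r β) (hExt : CylinderExt G)
    (g : Literature.Probability.LatticeModels.Site 4 → G) : μ.map (gaugeTransformZd g) = μ :=
  AdmissibleGap.map_gaugeTransformZd_eq r hμ hExt g

end Summit.QuantumFields.YangMills.Theorems.CriticalContinuumLimit

end
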